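import Summits.Ventures.PercRepro.K5LadderBridge
import Summits.Ventures.PercRepro.K4LadderLowerBridge
import Summits.Ventures.PercRepro.K5Layer5
import Summits.Ventures.PercRepro.K5Layer6
import Summits.Ventures.PercRepro.K5Layer7

/-!
# PercRepro — C-025 on `T_p(M(K₅) ⊕ U_{m,m})` at the layers `m = p + q − k`, `k = 5, 6, 7`: the matroid bridges (p9, gen 15; local draft)

The layers below the base layer of the `K₅` family (coranks `q + 3 … q + 5`), every level `q ≥ k`, every
`p ≥ q + 2`: at the layer `m = p + q − k` the orbits with `k₁ + k₂ < k` are inactive (`orbit_sum_U_inactive`), the others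
give `#U` and `#Y` as in `K5Layer<k>`, so the profile sums of `K5Matroid` reduce each count to the arithmetic
`k5_l<k>_base`, and **`rls_k5Ladder_layer<k>`** is C-025 on `T_p(M(K₅) ⊕ U_{p+q−k, p+q−k})` for every `q ≥ k`,
`p ≥ q + 2`. Nothing here is about any window of S4.
-/

namespace PercRepro.K5Ladder

open Set Finset PercRepro.LineLadder PercRepro.K4Ladder

variable {α : Type}

/-- **The layer-`5` inequality in profile form** (`q ≥ 5`, `p ≥ q + 2`, `m = p + q − 5`): the orbit sums with the
multiplicities of the profile table. -/
theorem k5_l5_ineq (p q : ℕ) (hq : 5 ≤ q) (hpq : q + 2 ≤ p) :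
    phiK p q * ((0 + 10 * (if 4 ≤ q then (p + q - 5).choose (q - 4) else 0)
        + 55 * (if 4 ≤ q then (p + q - 5).choose (q - 4) else 0)
        + 230 * (if 4 ≤ q then (p + q - 5).choose (q - 4) else 0) + 0
        + 10 * (if 1 ≤ q then (p + q - 5).choose (q - 1) else 0)
        + 55 * (if 2 ≤ q then (p + q - 5).choose (q - 2) else 0)
        + 230 * (if 3 ≤ q then (p + q - 5).choose (q - 3) else 0)
        + 432 * (if 4 ≤ q then (p + q - 5).choose (q - 4) else 0) : ℕ) : ℚ)
      ≤ ((∑ a ∈ Ico (q + 1) p, (p + q - 5).choose a + 10 * ∑ a ∈ Ico q (p - 1), (p + q - 5).choose a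
        + 55 * ∑ a ∈ Ico (q - 1) (p - 2), (p + q - 5).choose a
        + 230 * ∑ a ∈ Ico (q - 2) (p - 3), (p + q - 5).choose a
        + ∑ a ∈ Ico (q - 3) (p - 4), (p + q - 5).choose a
        + 10 * ∑ a ∈ Ico (q - 3) (p - 4), (p + q - 5).choose a
        + 55 * ∑ a ∈ Ico (q - 3) (p - 4), (p + q - 5).choose a
        + 230 * ∑ a ∈ Ico (q - 3) (p - 4), (p + q - 5).choose a
        + 432 * ∑ a ∈ Ico (q - 3) (p - 4), (p + q - 5).choose a : ℕ) : ℚ) := by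
  obtain ⟨r, rfl⟩ : ∃ r, q = r + 5 := ⟨q - 5, by omega⟩
  obtain ⟨s, rfl⟩ : ∃ s, p = r + s + 7 := ⟨p - r - 7, by omega⟩
  have h := k5_l5_base r s
  rw [if_pos (by omega : 4 ≤ r + 5), if_pos (by omega : 3 ≤ r + 5), if_pos (by omega : 2 ≤ r + 5), if_pos (by omega : 1 ≤ r + 5)]
  rw [show r + s + 7 + (r + 5) - 5 = 2 * r + s + 7 by omega, show r + 5 - 4 = r + 1 by omega, show r + 5 - 3 = r + 2 by omega, show r + 5 - 2 = r + 3 by omega, show r + 5 - 1 = r + 4 by omega, show r + 5 + 1 = r + 6 by omega, show r + s + 7 - 1 = r + s + 6 by omega, show r + s + 7 - 2 = r + s + 5 by omega, show r + s + 7 - 3 = r + s + 4 by omega, show r + s + 7 - 4 = r + s + 3 by omega]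
  have eU : (0 + 10 * (2 * r + s + 7).choose (r + 1) + 55 * (2 * r + s + 7).choose (r + 1)
      + 230 * (2 * r + s + 7).choose (r + 1) + 0 + 10 * (2 * r + s + 7).choose (r + 4)
      + 55 * (2 * r + s + 7).choose (r + 3) + 230 * (2 * r + s + 7).choose (r + 2)
      + 432 * (2 * r + s + 7).choose (r + 1) : ℕ)
      = 727 * (2 * r + s + 7).choose (r + 1) + 230 * (2 * r + s + 7).choose (r + 2)
        + 55 * (2 * r + s + 7).choose (r + 3) + 10 * (2 * r + s + 7).choose (r + 4) := by ring
  have eY : (∑ a ∈ Ico (r + 6) (r + s + 7), (2 * r + s + 7).choose a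
      + 10 * ∑ a ∈ Ico (r + 5) (r + s + 6), (2 * r + s + 7).choose a
      + 55 * ∑ a ∈ Ico (r + 4) (r + s + 5), (2 * r + s + 7).choose a
      + 230 * ∑ a ∈ Ico (r + 3) (r + s + 4), (2 * r + s + 7).choose a
      + ∑ a ∈ Ico (r + 2) (r + s + 3), (2 * r + s + 7).choose a
      + 10 * ∑ a ∈ Ico (r + 2) (r + s + 3), (2 * r + s + 7).choose a
      + 55 * ∑ a ∈ Ico (r + 2) (r + s + 3), (2 * r + s + 7).choose a
      + 230 * ∑ a ∈ Ico (r + 2) (r + s + 3), (2 * r + s + 7).choose a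
      + 432 * ∑ a ∈ Ico (r + 2) (r + s + 3), (2 * r + s + 7).choose a : ℕ)
      = ∑ a ∈ Ico (r + 6) (r + s + 7), (2 * r + s + 7).choose a
        + 10 * ∑ a ∈ Ico (r + 5) (r + s + 6), (2 * r + s + 7).choose a
        + 55 * ∑ a ∈ Ico (r + 4) (r + s + 5), (2 * r + s + 7).choose a
        + 230 * ∑ a ∈ Ico (r + 3) (r + s + 4), (2 * r + s + 7).choose a
        + 728 * ∑ a ∈ Ico (r + 2) (r + s + 3), (2 * r + s + 7).choose a := by ring
  rw [eU, eY]
  exact h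


/-- **C-025 ON `T_p(M(K₅) ⊕ U_{m,m})` AT THE LAYER `m = p + q − 5`** (corank `q + 5`), every level `q ≥ 5`,
every `p ≥ q + 2`. -/
theorem rls_k5Ladder_layer5 (e : Fin 10 ↪ α) {F : Set α} (hF : F.Finite)
    (hEF : Disjoint (K5.mapEmbedding e).E (Matroid.freeOn F).E) {p q : ℕ} (hFm : F.ncard = p + q - 5)
    (hq : 5 ≤ q) (hpq : q + 2 ≤ p) :
    @ThmN.RLS α (@PercRepro.Matroid.truncate α ((K5.mapEmbedding e).disjointSum (Matroid.freeOn F) hEF)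
        (@blockFree_finite α _ (mapK5_finite e) F hF hEF) p)
      (@PercRepro.Matroid.truncate_finite α _ (@blockFree_finite α _ (mapK5_finite e) F hF hEF) p) p q := by
  haveI := mapK5_finite e
  unfold ThmN.RLS
  rw [ncard_U_blockFree' (K5.mapEmbedding e) hF hEF p q, ncard_Y_blockFree' (K5.mapEmbedding e) hF hEF p q, hFm,
    finite_subsets_eq, Finset.sum_image (fun _ _ _ _ h => image_coe_injective e h),
    Finset.sum_image (fun _ _ _ _ h => image_coe_injective e h)]
  simp only [mapK5_eRk, mapK5_eRk_compl, ENat.toNat_coe]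
  show phiK p q * ((∑ x : Finset (Fin 10), orbU p q (p + q - 5) (profile x) : ℕ) : ℚ)
    ≤ ((∑ x : Finset (Fin 10), orbY p q (p + q - 5) (profile x) : ℕ) : ℚ)
  rw [sum_profile (orbU p q (p + q - 5)), sum_profile (orbY p q (p + q - 5))]
  simp only [orbU, orbY]
  have hqp : q < p := by omega
  rw [orbit_sum_U_inactive p q (p + q - 5) 0 4 hqp (by omega),
    orbit_sum_U p q (p + q - 5) 1 4 hqp (by omega),
    orbit_sum_U p q (p + q - 5) 2 4 hqp (by omega),
    orbit_sum_U p q (p + q - 5) 3 4 hqp (by omega),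
    orbit_sum_U_inactive p q (p + q - 5) 4 0 hqp (by omega),
    orbit_sum_U p q (p + q - 5) 4 1 hqp (by omega),
    orbit_sum_U p q (p + q - 5) 4 2 hqp (by omega),
    orbit_sum_U p q (p + q - 5) 4 3 hqp (by omega),
    orbit_sum_U p q (p + q - 5) 4 4 hqp (by omega),
    orbit_sum_Y p q (p + q - 5) 0, orbit_sum_Y p q (p + q - 5) 1, orbit_sum_Y p q (p + q - 5) 2, orbit_sum_Y p q (p + q - 5) 3, orbit_sum_Y p q (p + q - 5) 4]
  rw [show q + 1 - 0 = q + 1 by omega, show p - 0 = p by omega, show q + 1 - 1 = q by omega, show q + 1 - 2 = q - 1 by omega, show q + 1 - 3 = q - 2 by omega, show q + 1 - 4 = q - 3 by omega]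
  exact k5_l5_ineq p q hq hpq


/-- **The layer-`6` inequality in profile form** (`q ≥ 6`, `p ≥ q + 2`, `m = p + q − 6`): the orbit sums with the
multiplicities of the profile table. -/
theorem k5_l6_ineq (p q : ℕ) (hq : 6 ≤ q) (hpq : q + 2 ≤ p) :
    phiK p q * ((0 + 10 * 0 + 55 * (if 4 ≤ q then (p + q - 6).choose (q - 4) else 0)
        + 230 * (if 4 ≤ q then (p + q - 6).choose (q - 4) else 0) + 0 + 10 * 0
        + 55 * (if 2 ≤ q then (p + q - 6).choose (q - 2) else 0)
        + 230 * (if 3 ≤ q then (p + q - 6).choose (q - 3) else 0)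
        + 432 * (if 4 ≤ q then (p + q - 6).choose (q - 4) else 0) : ℕ) : ℚ)
      ≤ ((∑ a ∈ Ico (q + 1) p, (p + q - 6).choose a + 10 * ∑ a ∈ Ico q (p - 1), (p + q - 6).choose a
        + 55 * ∑ a ∈ Ico (q - 1) (p - 2), (p + q - 6).choose a
        + 230 * ∑ a ∈ Ico (q - 2) (p - 3), (p + q - 6).choose a
        + ∑ a ∈ Ico (q - 3) (p - 4), (p + q - 6).choose a
        + 10 * ∑ a ∈ Ico (q - 3) (p - 4), (p + q - 6).choose a
        + 55 * ∑ a ∈ Ico (q - 3) (p - 4), (p + q - 6).choose a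
        + 230 * ∑ a ∈ Ico (q - 3) (p - 4), (p + q - 6).choose a
        + 432 * ∑ a ∈ Ico (q - 3) (p - 4), (p + q - 6).choose a : ℕ) : ℚ) := by
  obtain ⟨r, rfl⟩ : ∃ r, q = r + 6 := ⟨q - 6, by omega⟩
  obtain ⟨s, rfl⟩ : ∃ s, p = r + s + 8 := ⟨p - r - 8, by omega⟩
  have h := k5_l6_base r s
  rw [if_pos (by omega : 4 ≤ r + 6), if_pos (by omega : 3 ≤ r + 6), if_pos (by omega : 2 ≤ r + 6)]
  rw [show r + s + 8 + (r + 6) - 6 = 2 * r + s + 8 by omega, show r + 6 - 4 = r + 2 by omega, show r + 6 - 3 = r + 3 by omega, show r + 6 - 2 = r + 4 by omega, show r + 6 + 1 = r + 7 by omega, show r + 6 - 1 = r + 5 by omega, show r + s + 8 - 1 = r + s + 7 by omega, show r + s + 8 - 2 = r + s + 6 by omega, show r + s + 8 - 3 = r + s + 5 by omega, show r + s + 8 - 4 = r + s + 4 by omega]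
  have eU : (0 + 10 * 0 + 55 * (2 * r + s + 8).choose (r + 2) + 230 * (2 * r + s + 8).choose (r + 2) + 0 + 10 * 0
      + 55 * (2 * r + s + 8).choose (r + 4) + 230 * (2 * r + s + 8).choose (r + 3)
      + 432 * (2 * r + s + 8).choose (r + 2) : ℕ)
      = 717 * (2 * r + s + 8).choose (r + 2) + 230 * (2 * r + s + 8).choose (r + 3)
        + 55 * (2 * r + s + 8).choose (r + 4) := by ring
  have eY : (∑ a ∈ Ico (r + 7) (r + s + 8), (2 * r + s + 8).choose a
      + 10 * ∑ a ∈ Ico (r + 6) (r + s + 7), (2 * r + s + 8).choose a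
      + 55 * ∑ a ∈ Ico (r + 5) (r + s + 6), (2 * r + s + 8).choose a
      + 230 * ∑ a ∈ Ico (r + 4) (r + s + 5), (2 * r + s + 8).choose a
      + ∑ a ∈ Ico (r + 3) (r + s + 4), (2 * r + s + 8).choose a
      + 10 * ∑ a ∈ Ico (r + 3) (r + s + 4), (2 * r + s + 8).choose a
      + 55 * ∑ a ∈ Ico (r + 3) (r + s + 4), (2 * r + s + 8).choose a
      + 230 * ∑ a ∈ Ico (r + 3) (r + s + 4), (2 * r + s + 8).choose a
      + 432 * ∑ a ∈ Ico (r + 3) (r + s + 4), (2 * r + s + 8).choose a : ℕ)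
      = ∑ a ∈ Ico (r + 7) (r + s + 8), (2 * r + s + 8).choose a
        + 10 * ∑ a ∈ Ico (r + 6) (r + s + 7), (2 * r + s + 8).choose a
        + 55 * ∑ a ∈ Ico (r + 5) (r + s + 6), (2 * r + s + 8).choose a
        + 230 * ∑ a ∈ Ico (r + 4) (r + s + 5), (2 * r + s + 8).choose a
        + 728 * ∑ a ∈ Ico (r + 3) (r + s + 4), (2 * r + s + 8).choose a := by ring
  rw [eU, eY]
  exact h


/-- **C-025 ON `T_p(M(K₅) ⊕ U_{m,m})` AT THE LAYER `m = p + q − 6`** (corank `q + 4`), every level `q ≥ 6`,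
every `p ≥ q + 2`. -/
theorem rls_k5Ladder_layer6 (e : Fin 10 ↪ α) {F : Set α} (hF : F.Finite)
    (hEF : Disjoint (K5.mapEmbedding e).E (Matroid.freeOn F).E) {p q : ℕ} (hFm : F.ncard = p + q - 6)
    (hq : 6 ≤ q) (hpq : q + 2 ≤ p) :
    @ThmN.RLS α (@PercRepro.Matroid.truncate α ((K5.mapEmbedding e).disjointSum (Matroid.freeOn F) hEF)
        (@blockFree_finite α _ (mapK5_finite e) F hF hEF) p)
      (@PercRepro.Matroid.truncate_finite α _ (@blockFree_finite α _ (mapK5_finite e) F hF hEF) p) p q := by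
  haveI := mapK5_finite e
  unfold ThmN.RLS
  rw [ncard_U_blockFree' (K5.mapEmbedding e) hF hEF p q, ncard_Y_blockFree' (K5.mapEmbedding e) hF hEF p q, hFm,
    finite_subsets_eq, Finset.sum_image (fun _ _ _ _ h => image_coe_injective e h),
    Finset.sum_image (fun _ _ _ _ h => image_coe_injective e h)]
  simp only [mapK5_eRk, mapK5_eRk_compl, ENat.toNat_coe]
  show phiK p q * ((∑ x : Finset (Fin 10), orbU p q (p + q - 6) (profile x) : ℕ) : ℚ)
    ≤ ((∑ x : Finset (Fin 10), orbY p q (p + q - 6) (profile x) : ℕ) : ℚ)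
  rw [sum_profile (orbU p q (p + q - 6)), sum_profile (orbY p q (p + q - 6))]
  simp only [orbU, orbY]
  have hqp : q < p := by omega
  rw [orbit_sum_U_inactive p q (p + q - 6) 0 4 hqp (by omega),
    orbit_sum_U_inactive p q (p + q - 6) 1 4 hqp (by omega),
    orbit_sum_U p q (p + q - 6) 2 4 hqp (by omega),
    orbit_sum_U p q (p + q - 6) 3 4 hqp (by omega),
    orbit_sum_U_inactive p q (p + q - 6) 4 0 hqp (by omega),
    orbit_sum_U_inactive p q (p + q - 6) 4 1 hqp (by omega),
    orbit_sum_U p q (p + q - 6) 4 2 hqp (by omega),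
    orbit_sum_U p q (p + q - 6) 4 3 hqp (by omega),
    orbit_sum_U p q (p + q - 6) 4 4 hqp (by omega),
    orbit_sum_Y p q (p + q - 6) 0, orbit_sum_Y p q (p + q - 6) 1, orbit_sum_Y p q (p + q - 6) 2, orbit_sum_Y p q (p + q - 6) 3, orbit_sum_Y p q (p + q - 6) 4]
  rw [show q + 1 - 0 = q + 1 by omega, show p - 0 = p by omega, show q + 1 - 1 = q by omega, show q + 1 - 2 = q - 1 by omega, show q + 1 - 3 = q - 2 by omega, show q + 1 - 4 = q - 3 by omega]
  exact k5_l6_ineq p q hq hpq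


/-- **The layer-`7` inequality in profile form** (`q ≥ 7`, `p ≥ q + 2`, `m = p + q − 7`): the orbit sums with the
multiplicities of the profile table. -/
theorem k5_l7_ineq (p q : ℕ) (hq : 7 ≤ q) (hpq : q + 2 ≤ p) :
    phiK p q * ((0 + 10 * 0 + 55 * 0 + 230 * (if 4 ≤ q then (p + q - 7).choose (q - 4) else 0) + 0 + 10 * 0 + 55 * 0
        + 230 * (if 3 ≤ q then (p + q - 7).choose (q - 3) else 0)
        + 432 * (if 4 ≤ q then (p + q - 7).choose (q - 4) else 0) : ℕ) : ℚ)
      ≤ ((∑ a ∈ Ico (q + 1) p, (p + q - 7).choose a + 10 * ∑ a ∈ Ico q (p - 1), (p + q - 7).choose a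
        + 55 * ∑ a ∈ Ico (q - 1) (p - 2), (p + q - 7).choose a
        + 230 * ∑ a ∈ Ico (q - 2) (p - 3), (p + q - 7).choose a
        + ∑ a ∈ Ico (q - 3) (p - 4), (p + q - 7).choose a
        + 10 * ∑ a ∈ Ico (q - 3) (p - 4), (p + q - 7).choose a
        + 55 * ∑ a ∈ Ico (q - 3) (p - 4), (p + q - 7).choose a
        + 230 * ∑ a ∈ Ico (q - 3) (p - 4), (p + q - 7).choose a
        + 432 * ∑ a ∈ Ico (q - 3) (p - 4), (p + q - 7).choose a : ℕ) : ℚ) := by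
  obtain ⟨r, rfl⟩ : ∃ r, q = r + 7 := ⟨q - 7, by omega⟩
  obtain ⟨s, rfl⟩ : ∃ s, p = r + s + 9 := ⟨p - r - 9, by omega⟩
  have h := k5_l7_base r s
  rw [if_pos (by omega : 4 ≤ r + 7), if_pos (by omega : 3 ≤ r + 7)]
  rw [show r + s + 9 + (r + 7) - 7 = 2 * r + s + 9 by omega, show r + 7 - 4 = r + 3 by omega, show r + 7 - 3 = r + 4 by omega, show r + 7 + 1 = r + 8 by omega, show r + 7 - 1 = r + 6 by omega, show r + 7 - 2 = r + 5 by omega, show r + s + 9 - 1 = r + s + 8 by omega, show r + s + 9 - 2 = r + s + 7 by omega, show r + s + 9 - 3 = r + s + 6 by omega, show r + s + 9 - 4 = r + s + 5 by omega]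
  have eU : (0 + 10 * 0 + 55 * 0 + 230 * (2 * r + s + 9).choose (r + 3) + 0 + 10 * 0 + 55 * 0
      + 230 * (2 * r + s + 9).choose (r + 4) + 432 * (2 * r + s + 9).choose (r + 3) : ℕ)
      = 662 * (2 * r + s + 9).choose (r + 3) + 230 * (2 * r + s + 9).choose (r + 4) := by ring
  have eY : (∑ a ∈ Ico (r + 8) (r + s + 9), (2 * r + s + 9).choose a
      + 10 * ∑ a ∈ Ico (r + 7) (r + s + 8), (2 * r + s + 9).choose a
      + 55 * ∑ a ∈ Ico (r + 6) (r + s + 7), (2 * r + s + 9).choose a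
      + 230 * ∑ a ∈ Ico (r + 5) (r + s + 6), (2 * r + s + 9).choose a
      + ∑ a ∈ Ico (r + 4) (r + s + 5), (2 * r + s + 9).choose a
      + 10 * ∑ a ∈ Ico (r + 4) (r + s + 5), (2 * r + s + 9).choose a
      + 55 * ∑ a ∈ Ico (r + 4) (r + s + 5), (2 * r + s + 9).choose a
      + 230 * ∑ a ∈ Ico (r + 4) (r + s + 5), (2 * r + s + 9).choose a
      + 432 * ∑ a ∈ Ico (r + 4) (r + s + 5), (2 * r + s + 9).choose a : ℕ)
      = ∑ a ∈ Ico (r + 8) (r + s + 9), (2 * r + s + 9).choose a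
        + 10 * ∑ a ∈ Ico (r + 7) (r + s + 8), (2 * r + s + 9).choose a
        + 55 * ∑ a ∈ Ico (r + 6) (r + s + 7), (2 * r + s + 9).choose a
        + 230 * ∑ a ∈ Ico (r + 5) (r + s + 6), (2 * r + s + 9).choose a
        + 728 * ∑ a ∈ Ico (r + 4) (r + s + 5), (2 * r + s + 9).choose a := by ring
  rw [eU, eY]
  exact h


/-- **C-025 ON `T_p(M(K₅) ⊕ U_{m,m})` AT THE LAYER `m = p + q − 7`** (corank `q + 3`), every level `q ≥ 7`,
every `p ≥ q + 2`. -/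
theorem rls_k5Ladder_layer7 (e : Fin 10 ↪ α) {F : Set α} (hF : F.Finite)
    (hEF : Disjoint (K5.mapEmbedding e).E (Matroid.freeOn F).E) {p q : ℕ} (hFm : F.ncard = p + q - 7)
    (hq : 7 ≤ q) (hpq : q + 2 ≤ p) :
    @ThmN.RLS α (@PercRepro.Matroid.truncate α ((K5.mapEmbedding e).disjointSum (Matroid.freeOn F) hEF)
        (@blockFree_finite α _ (mapK5_finite e) F hF hEF) p)
      (@PercRepro.Matroid.truncate_finite α _ (@blockFree_finite α _ (mapK5_finite e) F hF hEF) p) p q := by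
  haveI := mapK5_finite e
  unfold ThmN.RLS
  rw [ncard_U_blockFree' (K5.mapEmbedding e) hF hEF p q, ncard_Y_blockFree' (K5.mapEmbedding e) hF hEF p q, hFm,
    finite_subsets_eq, Finset.sum_image (fun _ _ _ _ h => image_coe_injective e h),
    Finset.sum_image (fun _ _ _ _ h => image_coe_injective e h)]
  simp only [mapK5_eRk, mapK5_eRk_compl, ENat.toNat_coe]
  show phiK p q * ((∑ x : Finset (Fin 10), orbU p q (p + q - 7) (profile x) : ℕ) : ℚ)
    ≤ ((∑ x : Finset (Fin 10), orbY p q (p + q - 7) (profile x) : ℕ) : ℚ)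
  rw [sum_profile (orbU p q (p + q - 7)), sum_profile (orbY p q (p + q - 7))]
  simp only [orbU, orbY]
  have hqp : q < p := by omega
  rw [orbit_sum_U_inactive p q (p + q - 7) 0 4 hqp (by omega),
    orbit_sum_U_inactive p q (p + q - 7) 1 4 hqp (by omega),
    orbit_sum_U_inactive p q (p + q - 7) 2 4 hqp (by omega),
    orbit_sum_U p q (p + q - 7) 3 4 hqp (by omega),
    orbit_sum_U_inactive p q (p + q - 7) 4 0 hqp (by omega),
    orbit_sum_U_inactive p q (p + q - 7) 4 1 hqp (by omega),
    orbit_sum_U_inactive p q (p + q - 7) 4 2 hqp (by omega),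
    orbit_sum_U p q (p + q - 7) 4 3 hqp (by omega),
    orbit_sum_U p q (p + q - 7) 4 4 hqp (by omega),
    orbit_sum_Y p q (p + q - 7) 0, orbit_sum_Y p q (p + q - 7) 1, orbit_sum_Y p q (p + q - 7) 2, orbit_sum_Y p q (p + q - 7) 3, orbit_sum_Y p q (p + q - 7) 4]
  rw [show q + 1 - 0 = q + 1 by omega, show p - 0 = p by omega, show q + 1 - 1 = q by omega, show q + 1 - 2 = q - 1 by omega, show q + 1 - 3 = q - 2 by omega, show q + 1 - 4 = q - 3 by omega]
  exact k5_l7_ineq p q hq hpq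


end PercRepro.K5Ladder
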